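import Summits.Ventures.PercRepro.RankLevelSetHallDemandHarmonic
import Summits.Ventures.PercRepro.RankLevelSetHallCapLymCount

/-!
# PercRepro — THE DEMAND-HARMONIC RECEIPT OF A FAT MEMBER IS AT LEAST `k`
(p4, gen 40; paper proofs/P4-DEMAND.md §3; C-044 at the tight layer `#E = p + q`, any `k = p − q ≥ 2`)

A member `Z` is FAT when `#(cl Z ∖ Z) = q` (its flat `F = cl Z` has `2q` points, the largest possible).  THIS FILE proves the
demand-harmonic receipt condition of RankLevelSetHallDemandHarmonic for fat members, with the sharp constant: the big supersets
`Z ∪ A ∪ U` (`A ⊆ cl Z ∖ Z`, `U ⊆ E ∖ cl Z`, `#A + #U = k`, `A ≠ ∅`, `U ≠ ∅`) are distinct big sets of size `p`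
(`mem_bigPSupersets_union`), every member inside one of them lies inside `Z ∪ A` — no member straddles the flat, because
`E ∖ Z'` is independent and would contain `q + #(Z' ∖ F) > q` points of the rank-`q` flat `F` (`member_subset_of_fat`) — and is
fat itself, so `Δ(Z ∪ A ∪ U) ≤ C(q + #A, q)·δ_q` (`bigDemand_union_le`); summing, `Σ_B 1/Δ(B) ≥ Σ_{a=1}^{k−1} C(q,a)·C(k,a)/(C(q+a,q)·δ_q) ≥ k`
(`k ≤ C(k, a)` for `1 ≤ a ≤ k − 1`, `le_choose_of_pos_of_lt`).  This is the extremal case of the census (receipt exactly `2` on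
`U_{q,2q} ⊕ Free(2)` at `k = 2`); the general condition stays a `Prop`.

* `le_choose_of_pos_of_lt`, `lostDemand_of_fat`, `member_subset_of_fat`, `mem_bigPSupersets_union`, `bigDemand_union_le`;
* **`demandHarmonic_recv_of_fat`**.
Axioms: standard.
-/

namespace PercRepro

open Set Matroid Finset

/-- `k ≤ C(k, a)` for `1 ≤ a < k`. -/
theorem le_choose_of_pos_of_lt {k a : ℕ} (ha : 1 ≤ a) (hak : a < k) : k ≤ k.choose a := by
  induction k with
  | zero => omega
  | succ k ih =>
    rcases Nat.lt_or_ge a k with hlt | hge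
    · have h1 := ih hlt
      have h2 : 1 ≤ k.choose (a - 1) := Nat.choose_pos (by omega)
      have h3 : (k + 1).choose a = k.choose a + k.choose (a - 1) := by
        obtain ⟨b, rfl⟩ : ∃ b, a = b + 1 := ⟨a - 1, by omega⟩
        rw [Nat.choose_succ_succ, add_comm]
        simp
      omega
    · have hak' : a = k := by omega
      subst hak'
      rw [Nat.choose_succ_self_right]

variable {α : Type} (M : Matroid α) [M.Finite]

omit [M.Finite] in
/-- A fat member has demand `δ_q = Σ_{a=1}^{k−1} C(q, a)/C(q + a, q)`. -/
theorem lostDemand_of_fat (p q : ℕ) {Z : Set α} (hd : (M.closure Z \ Z).ncard = q) :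
    lostDemand M p q Z = ∑ a ∈ Finset.Ioo 0 (p - q), ((q.choose a : ℕ) : ℚ) / (((q + a).choose q : ℕ) : ℚ) := by
  unfold lostDemand
  rw [hd]

/-- **No member straddles a fat flat**: a member inside `Z ∪ A ∪ U` (`Z` fat, `U ∩ cl Z = ∅`) lies inside `Z ∪ A`. -/
theorem member_subset_of_fat (p q : ℕ) (hE : M.E.ncard = p + q) {Z : Set α} (hZ : Z ∈ cellMembers M p q)
    (hd : (M.closure Z \ Z).ncard = q) {A U Z' : Set α} (hU : Disjoint U (M.closure Z))
    (hZ' : Z' ∈ cellMembers M p q) (hZ'B : Z' ⊆ Z ∪ A ∪ U) : Z' ⊆ Z ∪ A := by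
  have hEfin : M.E.Finite := M.set_finite M.E
  set F : Set α := M.closure Z with hF
  have hFE : F ⊆ M.E := M.closure_subset_ground Z
  have hFfin : F.Finite := hEfin.subset hFE
  have hZF : Z ⊆ F := M.subset_closure Z hZ.1
  have hZq : Z.ncard = q := ncard_eq_q_of_mem_cellMembers_tight M hE hZ
  have hFcard : F.ncard = 2 * q := by
    have := Set.ncard_sdiff_add_ncard_of_subset hZF hFfin
    rw [hd, hZq] at this
    omega
  -- the complement of Z' is independent, so F ∖ Z' is an independent subset of the rank-q flat F
  have hind : M.Indep (M.E \ Z') := (compl_indep_of_mem_U M hE hZ').1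
  have hFZ'ind : M.Indep (F \ Z') := hind.subset (fun x hx => ⟨hFE hx.1, hx.2⟩)
  have hFZ'fin : (F \ Z').Finite := hFfin.subset sdiff_subset
  have hle : (F \ Z').ncard ≤ q := by
    have h := hFZ'ind.encard_le_eRk_of_subset (sdiff_subset : F \ Z' ⊆ F)
    rw [hF, M.eRk_closure_eq, hZ.2.1, ← hFZ'fin.cast_ncard_eq] at h
    exact_mod_cast h
  -- #(F ∖ Z') = 2q − #(Z' ∩ F) and #(Z' ∩ F) ≤ q, so Z' ⊆ F
  have hZ'q : Z'.ncard = q := ncard_eq_q_of_mem_cellMembers_tight M hE hZ'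
  have hZ'fin : Z'.Finite := hEfin.subset hZ'.1
  have h1 : (F \ Z').ncard + (F ∩ Z').ncard = F.ncard := by
    rw [← Set.ncard_union_eq (Set.disjoint_sdiff_inter) (hFfin.subset sdiff_subset) (hFfin.subset Set.inter_subset_left),
      Set.sdiff_union_inter]
  have h2 : (F ∩ Z').ncard ≤ Z'.ncard := Set.ncard_le_ncard Set.inter_subset_right hZ'fin
  have hFZ'eq : (F ∩ Z').ncard = Z'.ncard := by omega
  have hsub : Z' ⊆ F := by
    have := Set.eq_of_subset_of_ncard_le (Set.inter_subset_right : F ∩ Z' ⊆ Z') (by omega) hZ'fin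
    intro x hx
    rw [← this] at hx
    exact hx.1
  -- hence Z' ⊆ (Z ∪ A ∪ U) ∩ F = Z ∪ A
  intro x hx
  have hxF : x ∈ F := hsub hx
  rcases hZ'B hx with (h | h) | h
  · exact Or.inl h
  · exact Or.inr h
  · exact absurd hxF (Set.disjoint_left.1 hU h)

/-- The set `Z ∪ A ∪ U` (`A ⊆ cl Z ∖ Z`, `U ⊆ E ∖ cl Z`, `1 ≤ #U ≤ k − 1`, `#A + #U = k`) is a big superset of `Z` of size `p`. -/
theorem mem_bigPSupersets_union (p q : ℕ) (hE : M.E.ncard = p + q) {Z : Set α} (hZ : Z ∈ cellMembers M p q)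
    {A U : Set α} (hA : A ⊆ M.closure Z \ Z) (hU : U ⊆ M.E \ M.closure Z) (hUfin : U.Finite) (hAfin : A.Finite)
    (hU1 : 1 ≤ U.ncard) (hUk : U.ncard + q < p) (hAU : A.ncard + U.ncard = p - q) :
    Z ∪ A ∪ U ∈ bigPSupersets M p q Z := by
  have hZE : Z ⊆ M.E := hZ.1
  have hZq : Z.ncard = q := ncard_eq_q_of_mem_cellMembers_tight M hE hZ
  have hZfin : Z.Finite := (M.set_finite M.E).subset hZE
  have hY : Z ∪ A ∪ U ∈ cellY M p q := mem_cellY_union M p q hZ hA hU hUfin hU1 hUk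
  have hcard : (Z ∪ A ∪ U).ncard = p := by
    have hdisj1 : Disjoint Z A := by
      rw [Set.disjoint_left]
      intro x hxZ hxA
      exact (hA hxA).2 hxZ
    have hdisj2 : Disjoint (Z ∪ A) U := by
      rw [Set.disjoint_left]
      intro x hx hxU
      have hxcl : x ∈ M.closure Z := by
        rcases hx with h | h
        · exact M.subset_closure Z hZE h
        · exact (hA h).1
      exact (hU hxU).2 hxcl
    rw [Set.ncard_union_eq hdisj2 (hZfin.union hAfin) hUfin, Set.ncard_union_eq hdisj1 hZfin hAfin, hZq]
    omega
  refine ⟨⟨⟨hY.1, hY.2.1, hY.2.2, Z, hZ, ?_⟩, ?_⟩, ?_, hcard⟩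
  · exact Set.subset_union_left.trans Set.subset_union_left
  · rw [hcard]
  · exact Set.subset_union_left.trans Set.subset_union_left

/-- **The demand inside `Z ∪ A ∪ U` for a fat `Z` is at most `C(q + #A, q)·δ_q`**: every member inside it lies inside `Z ∪ A`
(`member_subset_of_fat`), is fat (its closure is the flat `cl Z`), and there are at most `C(q + #A, q)` of them. -/
theorem bigDemand_union_le (p q : ℕ) (hE : M.E.ncard = p + q) {Z : Set α} (hZ : Z ∈ cellMembers M p q)
    (hd : (M.closure Z \ Z).ncard = q) {A U : Set α} (hA : A ⊆ M.closure Z \ Z) (hU : U ⊆ M.E \ M.closure Z)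
    (hAfin : A.Finite) :
    bigDemand M p q (Z ∪ A ∪ U) ≤ (((Z ∪ A).ncard.choose q : ℕ) : ℚ) * lostDemand M p q Z := by
  classical
  have hZE : Z ⊆ M.E := hZ.1
  have hEfin : M.E.Finite := M.set_finite M.E
  have hZfin : Z.Finite := hEfin.subset hZE
  have hZAfin : (Z ∪ A).Finite := hZfin.union hAfin
  have hA' : A ⊆ M.closure Z := fun x hx => (hA hx).1
  have hU' : Disjoint U (M.closure Z) := by
    rw [Set.disjoint_left]
    intro x hxU hxcl
    exact (hU hxU).2 hxcl
  set Mf : Finset (Set α) := (cellMembers_finite M p q).toFinset with hMf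
  have hmemMf : ∀ Z', Z' ∈ Mf ↔ Z' ∈ cellMembers M p q := fun Z' => by rw [hMf, Set.Finite.mem_toFinset]
  -- every member inside Z ∪ A ∪ U is inside Z ∪ A, and is fat with the same demand
  have hfilt : Mf.filter (fun Z' => Z' ⊆ Z ∪ A ∪ U) ⊆ Mf.filter (fun Z' => Z' ⊆ Z ∪ A) := by
    intro Z' hZ'
    rw [Finset.mem_filter] at hZ' ⊢
    exact ⟨hZ'.1, member_subset_of_fat M p q hE hZ hd hU' ((hmemMf Z').1 hZ'.1) hZ'.2⟩
  have hsame : ∀ Z' ∈ Mf.filter (fun Z' => Z' ⊆ Z ∪ A), lostDemand M p q Z' = lostDemand M p q Z := by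
    intro Z' hZ'
    rw [Finset.mem_filter, hmemMf] at hZ'
    obtain ⟨hZ'm, hZ'sub⟩ := hZ'
    -- Z' ⊆ cl Z with the same rank, so cl Z' = cl Z
    have hZ'cl : Z' ⊆ M.closure Z :=
      hZ'sub.trans (Set.union_subset (M.subset_closure Z hZE) hA')
    have hZ'fin : Z'.Finite := hEfin.subset hZ'm.1
    have hrk : M.eRk (M.closure Z) ≤ M.eRk Z' := by
      rw [M.eRk_closure_eq, hZ.2.1, hZ'm.2.1]
    have hcl := (M.isRkFinite_of_finite hZ'fin).closure_eq_closure_of_subset_of_eRk_ge_eRk hZ'cl hrk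
    rw [M.closure_closure] at hcl
    have hd' : (M.closure Z' \ Z').ncard = q := by
      rw [hcl]
      have hZ'q : Z'.ncard = q := ncard_eq_q_of_mem_cellMembers_tight M hE hZ'm
      have hZq : Z.ncard = q := ncard_eq_q_of_mem_cellMembers_tight M hE hZ
      have hFfin : (M.closure Z).Finite := hEfin.subset (M.closure_subset_ground Z)
      have h1 := Set.ncard_sdiff_add_ncard_of_subset hZ'cl hFfin
      have h2 := Set.ncard_sdiff_add_ncard_of_subset (M.subset_closure Z hZE) hFfin
      omega
    rw [lostDemand_of_fat M p q hd', lostDemand_of_fat M p q hd]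
  have hcount : (Mf.filter (fun Z' => Z' ⊆ Z ∪ A)).card ≤ (Z ∪ A).ncard.choose q :=
    card_filter_members_subset_le_choose M p q hE Mf (fun Z' hZ' => (hmemMf Z').1 hZ') hZAfin
  unfold bigDemand
  calc ∑ Z' ∈ Mf.filter (fun Z' => Z' ⊆ Z ∪ A ∪ U), lostDemand M p q Z'
      ≤ ∑ Z' ∈ Mf.filter (fun Z' => Z' ⊆ Z ∪ A), lostDemand M p q Z' :=
        Finset.sum_le_sum_of_subset_of_nonneg hfilt (fun Z' _ _ => lostDemand_nonneg M p q Z')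
    _ = ∑ Z' ∈ Mf.filter (fun Z' => Z' ⊆ Z ∪ A), lostDemand M p q Z := Finset.sum_congr rfl hsame
    _ = ((Mf.filter (fun Z' => Z' ⊆ Z ∪ A)).card : ℚ) * lostDemand M p q Z := by
        rw [Finset.sum_const, nsmul_eq_mul]
    _ ≤ (((Z ∪ A).ncard.choose q : ℕ) : ℚ) * lostDemand M p q Z := by
        apply mul_le_mul_of_nonneg_right _ (lostDemand_nonneg M p q Z)
        exact_mod_cast hcount

/-- **THE DEMAND-HARMONIC RECEIPT OF A FAT MEMBER IS AT LEAST `k`**: for a member `Z` with `#(cl Z ∖ Z) = q` at the tight layer,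
`Σ_{B ∈ bigPSupersets(Z)} 1/Δ(B) ≥ p − q` (`q ≥ 1`). -/
theorem demandHarmonic_recv_of_fat (p q : ℕ) (hq : 1 ≤ q) (hp : q + 2 ≤ p) (hE : M.E.ncard = p + q) {Z : Set α}
    (hZ : Z ∈ cellMembers M p q) (hd : (M.closure Z \ Z).ncard = q) :
    ((p - q : ℕ) : ℚ) ≤ ∑ B ∈ (bigPSupersets_finite M p q Z).toFinset, 1 / bigDemand M p q B := by
  classical
  have hZE : Z ⊆ M.E := hZ.1
  have hZq : Z.ncard = q := ncard_eq_q_of_mem_cellMembers_tight M hE hZ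
  set k : ℕ := p - q with hk
  have hk2 : 2 ≤ k := by omega
  set F : Set α := M.closure Z with hF
  have hFE : F ⊆ M.E := M.closure_subset_ground Z
  have hZF : Z ⊆ F := M.subset_closure Z hZE
  set D : Set α := F \ Z with hD
  set O : Set α := M.E \ F with hO
  have hEfin : M.E.Finite := M.set_finite M.E
  have hFfin : F.Finite := hEfin.subset hFE
  have hDfin : D.Finite := hFfin.subset sdiff_subset
  have hOfin : O.Finite := hEfin.subset sdiff_subset
  have hZfin : Z.Finite := hEfin.subset hZE
  have hFcard : F.ncard = 2 * q := by
    have := Set.ncard_sdiff_add_ncard_of_subset hZF hFfin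
    rw [← hD] at this
    rw [hd, hZq] at this
    omega
  have hOcard : O.ncard = k := by
    have := Set.ncard_sdiff_add_ncard_of_subset hFE hEfin
    rw [← hO, hE, hFcard] at this
    omega
  set Df : Finset α := hDfin.toFinset with hDf
  set Of : Finset α := hOfin.toFinset with hOf
  have hDcard : Df.card = q := by rw [hDf, ← ncard_eq_toFinset_card _ hDfin, hd]
  have hOcard' : Of.card = k := by rw [hOf, ← ncard_eq_toFinset_card _ hOfin, hOcard]
  have hmemDf : ∀ x, x ∈ Df ↔ x ∈ F ∧ x ∉ Z := fun x => by rw [hDf, Set.Finite.mem_toFinset, hD, Set.mem_sdiff]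
  have hmemOf : ∀ x, x ∈ Of ↔ x ∈ M.E ∧ x ∉ F := fun x => by rw [hOf, Set.Finite.mem_toFinset, hO, Set.mem_sdiff]
  set Bf : Finset (Set α) := (bigPSupersets_finite M p q Z).toFinset with hBf
  have hmemBf : ∀ B, B ∈ Bf ↔ B ∈ bigPSupersets M p q Z := fun B => by rw [hBf, Set.Finite.mem_toFinset]
  -- the pairs (A, U): A ⊆ Df nonempty, U ⊆ Of nonempty, #A + #U = k
  set P : Finset (Finset α × Finset α) :=
    (Df.powerset ×ˢ Of.powerset).filter (fun pr => 0 < pr.1.card ∧ 0 < pr.2.card ∧ pr.1.card + pr.2.card = k) with hP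
  let φ : Finset α × Finset α → Set α := fun pr => Z ∪ (pr.1 : Set α) ∪ (pr.2 : Set α)
  have hpair : ∀ pr ∈ P, (pr.1 : Set α) ⊆ D ∧ (pr.2 : Set α) ⊆ O ∧ 0 < pr.1.card ∧ 0 < pr.2.card ∧ pr.1.card + pr.2.card = k := by
    intro pr hpr
    rw [hP, Finset.mem_filter, Finset.mem_product, Finset.mem_powerset, Finset.mem_powerset] at hpr
    obtain ⟨⟨h1, h2⟩, h3, h4, h5⟩ := hpr
    refine ⟨?_, ?_, h3, h4, h5⟩
    · intro x hx
      have := h1 (Finset.mem_coe.1 hx)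
      rw [hDf, Set.Finite.mem_toFinset] at this
      exact this
    · intro x hx
      have := h2 (Finset.mem_coe.1 hx)
      rw [hOf, Set.Finite.mem_toFinset] at this
      exact this
  have hADU : ∀ pr ∈ P, (pr.1 : Set α) ⊆ M.closure Z \ Z ∧ (pr.2 : Set α) ⊆ M.E \ M.closure Z := by
    intro pr hpr
    obtain ⟨h1, h2, -, -, -⟩ := hpair pr hpr
    exact ⟨h1, h2⟩
  -- the image lies in Bf
  have himage : P.image φ ⊆ Bf := by
    intro B hB
    rw [Finset.mem_image] at hB
    obtain ⟨pr, hpr, rfl⟩ := hB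
    obtain ⟨h1, h2, h3, h4, h5⟩ := hpair pr hpr
    rw [hmemBf]
    apply mem_bigPSupersets_union M p q hE hZ h1 h2 (Finset.finite_toSet _) (Finset.finite_toSet _)
    · rw [ncard_coe_finset]; exact h4
    · rw [ncard_coe_finset]; omega
    · rw [ncard_coe_finset, ncard_coe_finset]; rw [← hk]; exact h5
  -- φ is injective on P
  have hinj : ∀ pr ∈ P, ∀ pr' ∈ P, φ pr = φ pr' → pr = pr' := by
    intro pr hpr pr' hpr' heq
    obtain ⟨h1, h2, -, -, -⟩ := hpair pr hpr
    obtain ⟨h1', h2', -, -, -⟩ := hpair pr' hpr'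
    have hZcl : Z ⊆ M.closure Z := hZF
    have hsd : ∀ (A U : Finset α), (A : Set α) ⊆ D → (U : Set α) ⊆ O →
        (Z ∪ (A : Set α) ∪ (U : Set α)) \ M.closure Z = (U : Set α) ∧
        (Z ∪ (A : Set α) ∪ (U : Set α)) ∩ M.closure Z = Z ∪ (A : Set α) := by
      intro A U hA hU
      have hA' : (A : Set α) ⊆ M.closure Z := fun x hx => (hA hx).1
      have hU' : Disjoint (U : Set α) (M.closure Z) := by
        rw [Set.disjoint_left]
        intro x hxU hxcl
        exact (hU hxU).2 hxcl
      exact ⟨union_sdiff_closure M Z _ _ hZE hA' hU', union_inter_closure M Z _ _ hZE hA' hU'⟩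
    obtain ⟨hs1, hs2⟩ := hsd pr.1 pr.2 h1 h2
    obtain ⟨hs1', hs2'⟩ := hsd pr'.1 pr'.2 h1' h2'
    have hU : pr.2 = pr'.2 := by
      have : (pr.2 : Set α) = (pr'.2 : Set α) := by
        rw [← hs1, ← hs1']
        show φ pr \ M.closure Z = φ pr' \ M.closure Z
        rw [heq]
      exact Finset.coe_injective this
    have hA : pr.1 = pr'.1 := by
      have hdiff : ∀ (A : Finset α), (A : Set α) ⊆ D → (Z ∪ (A : Set α)) \ Z = (A : Set α) := by
        intro A hA
        ext x
        simp only [Set.mem_sdiff, Set.mem_union]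
        constructor
        · rintro ⟨h | h, hx⟩
          · exact absurd h hx
          · exact h
        · intro h
          exact ⟨Or.inr h, (hA h).2⟩
      have : (pr.1 : Set α) = (pr'.1 : Set α) := by
        rw [← hdiff pr.1 h1, ← hdiff pr'.1 h1', ← hs2, ← hs2']
        show (φ pr ∩ M.closure Z) \ Z = (φ pr' ∩ M.closure Z) \ Z
        rw [heq]
      exact Finset.coe_injective this
    exact Prod.ext hA hU
  -- each pair contributes at least 1/(C(q + #A, q)·δ_q)
  have hδpos : 0 < lostDemand M p q Z := by
    rw [lostDemand_of_fat M p q hd]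
    apply lt_of_lt_of_le _ (Finset.single_le_sum (f := fun a => ((q.choose a : ℕ) : ℚ) / (((q + a).choose q : ℕ) : ℚ))
      (fun a _ => by positivity) (show 1 ∈ Finset.Ioo 0 (p - q) by rw [Finset.mem_Ioo]; omega))
    have h1 : (0 : ℚ) < ((q.choose 1 : ℕ) : ℚ) := by
      rw [Nat.choose_one_right]
      exact_mod_cast (show 0 < q by omega)
    have h2 : (0 : ℚ) < (((q + 1).choose q : ℕ) : ℚ) := by exact_mod_cast Nat.choose_pos (by omega)
    exact div_pos h1 h2
  have hterm : ∀ pr ∈ P, 1 / ((((q + pr.1.card).choose q : ℕ) : ℚ) * lostDemand M p q Z) ≤ 1 / bigDemand M p q (φ pr) := by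
    intro pr hpr
    obtain ⟨h1, h2, -, -, -⟩ := hpair pr hpr
    have hA' : (pr.1 : Set α) ⊆ M.closure Z \ Z := h1
    have hU' : (pr.2 : Set α) ⊆ M.E \ M.closure Z := h2
    have hle := bigDemand_union_le M p q hE hZ hd hA' hU' (Finset.finite_toSet _)
    have hcard : (Z ∪ (pr.1 : Set α)).ncard = q + pr.1.card := by
      have hdisj : Disjoint Z (pr.1 : Set α) := by
        rw [Set.disjoint_left]
        intro x hxZ hxA
        exact (h1 hxA).2 hxZ
      rw [Set.ncard_union_eq hdisj hZfin (Finset.finite_toSet _), hZq, ncard_coe_finset]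
    rw [hcard] at hle
    have hpos : 0 < bigDemand M p q (φ pr) := by
      have hZsub : Z ⊆ φ pr := Set.subset_union_left.trans Set.subset_union_left
      exact lt_of_lt_of_le hδpos (lostDemand_le_bigDemand M p q hZ hZsub)
    exact one_div_le_one_div_of_le hpos hle
  -- the sum over the pairs
  have hstep1 : ∑ B ∈ P.image φ, 1 / bigDemand M p q B ≤ ∑ B ∈ Bf, 1 / bigDemand M p q B :=
    Finset.sum_le_sum_of_subset_of_nonneg himage (fun B _ _ => by
      apply div_nonneg zero_le_one (bigDemand_nonneg M p q B))
  have hstep2 : ∑ B ∈ P.image φ, 1 / bigDemand M p q B = ∑ pr ∈ P, 1 / bigDemand M p q (φ pr) :=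
    Finset.sum_image hinj
  have hstep3 : ∑ pr ∈ P, 1 / ((((q + pr.1.card).choose q : ℕ) : ℚ) * lostDemand M p q Z)
      ≤ ∑ pr ∈ P, 1 / bigDemand M p q (φ pr) := Finset.sum_le_sum hterm
  -- evaluate the pair sum: Σ_{a} C(q,a)·C(k, k−a) / (C(q+a,q)·δ_q)
  have hstep4 : ∑ pr ∈ P, 1 / ((((q + pr.1.card).choose q : ℕ) : ℚ) * lostDemand M p q Z)
      = ∑ a ∈ Finset.Ioo 0 k, ((q.choose a : ℕ) : ℚ) * ((k.choose (k - a) : ℕ) : ℚ)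
          * (1 / ((((q + a).choose q : ℕ) : ℚ) * lostDemand M p q Z)) := by
    -- group the pairs by #A = a: the A's are the a-subsets of Df, the U's the (k−a)-subsets of Of
    have hsplit : P = (Finset.Ioo 0 k).biUnion (fun a => (Df.powersetCard a) ×ˢ (Of.powersetCard (k - a))) := by
      ext pr
      rw [hP, Finset.mem_filter, Finset.mem_product, Finset.mem_powerset, Finset.mem_powerset, Finset.mem_biUnion]
      constructor
      · rintro ⟨⟨h1, h2⟩, h3, h4, h5⟩
        refine ⟨pr.1.card, ?_, ?_⟩
        · rw [Finset.mem_Ioo]; omega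
        · rw [Finset.mem_product, Finset.mem_powersetCard, Finset.mem_powersetCard]
          exact ⟨⟨h1, rfl⟩, h2, by omega⟩
      · rintro ⟨a, ha, hpr⟩
        rw [Finset.mem_Ioo] at ha
        rw [Finset.mem_product, Finset.mem_powersetCard, Finset.mem_powersetCard] at hpr
        obtain ⟨⟨h1, h1c⟩, h2, h2c⟩ := hpr
        exact ⟨⟨h1, h2⟩, by omega, by omega, by omega⟩
    have hdisj : ∀ a ∈ Finset.Ioo 0 k, ∀ b ∈ Finset.Ioo 0 k, a ≠ b →
        Disjoint ((Df.powersetCard a) ×ˢ (Of.powersetCard (k - a))) ((Df.powersetCard b) ×ˢ (Of.powersetCard (k - b))) := by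
      intro a _ b _ hab
      rw [Finset.disjoint_left]
      intro pr h1 h2
      rw [Finset.mem_product, Finset.mem_powersetCard] at h1 h2
      exact hab (h1.1.2.symm.trans h2.1.2)
    rw [hsplit, Finset.sum_biUnion hdisj]
    apply Finset.sum_congr rfl
    intro a ha
    rw [Finset.sum_product]
    have hconst : ∀ A ∈ Df.powersetCard a, ∑ U ∈ Of.powersetCard (k - a),
        1 / ((((q + A.card).choose q : ℕ) : ℚ) * lostDemand M p q Z)
        = ((k.choose (k - a) : ℕ) : ℚ) * (1 / ((((q + a).choose q : ℕ) : ℚ) * lostDemand M p q Z)) := by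
      intro A hA
      rw [Finset.mem_powersetCard] at hA
      rw [hA.2, Finset.sum_const, Finset.card_powersetCard, hOcard', nsmul_eq_mul]
    rw [Finset.sum_congr rfl hconst, Finset.sum_const, Finset.card_powersetCard, hDcard, nsmul_eq_mul]
    ring
  -- the arithmetic: C(k, k−a) = C(k, a) ≥ k for 0 < a < k, so the sum is ≥ k·Σ_a C(q,a)/(C(q+a,q)·δ_q) = k
  have harith : (k : ℚ) ≤ ∑ a ∈ Finset.Ioo 0 k, ((q.choose a : ℕ) : ℚ) * ((k.choose (k - a) : ℕ) : ℚ)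
          * (1 / ((((q + a).choose q : ℕ) : ℚ) * lostDemand M p q Z)) := by
    have hsumδ : ∑ a ∈ Finset.Ioo 0 k, ((q.choose a : ℕ) : ℚ) / (((q + a).choose q : ℕ) : ℚ) = lostDemand M p q Z := by
      rw [lostDemand_of_fat M p q hd]
    have hge : ∀ a ∈ Finset.Ioo 0 k, (k : ℚ) * (((q.choose a : ℕ) : ℚ) / (((q + a).choose q : ℕ) : ℚ) / lostDemand M p q Z)
        ≤ ((q.choose a : ℕ) : ℚ) * ((k.choose (k - a) : ℕ) : ℚ) * (1 / ((((q + a).choose q : ℕ) : ℚ) * lostDemand M p q Z)) := by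
      intro a ha
      rw [Finset.mem_Ioo] at ha
      have hkc : (k : ℚ) ≤ ((k.choose (k - a) : ℕ) : ℚ) := by
        exact_mod_cast le_choose_of_pos_of_lt (by omega) (by omega)
      have hpos1 : (0 : ℚ) < (((q + a).choose q : ℕ) : ℚ) := by exact_mod_cast Nat.choose_pos (by omega)
      have hq0 : (0 : ℚ) ≤ ((q.choose a : ℕ) : ℚ) := by positivity
      have hrhs : ((q.choose a : ℕ) : ℚ) * ((k.choose (k - a) : ℕ) : ℚ)
          * (1 / ((((q + a).choose q : ℕ) : ℚ) * lostDemand M p q Z))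
          = ((k.choose (k - a) : ℕ) : ℚ) * (((q.choose a : ℕ) : ℚ) / (((q + a).choose q : ℕ) : ℚ) / lostDemand M p q Z) := by
        field_simp
      rw [hrhs]
      apply mul_le_mul_of_nonneg_right hkc
      exact div_nonneg (div_nonneg hq0 hpos1.le) hδpos.le
    calc (k : ℚ) = (k : ℚ) * (lostDemand M p q Z / lostDemand M p q Z) := by rw [div_self hδpos.ne', mul_one]
      _ = ∑ a ∈ Finset.Ioo 0 k, (k : ℚ) * (((q.choose a : ℕ) : ℚ) / (((q + a).choose q : ℕ) : ℚ) / lostDemand M p q Z) := by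
          rw [← hsumδ, Finset.sum_div, Finset.mul_sum]
      _ ≤ _ := Finset.sum_le_sum hge
  calc ((p - q : ℕ) : ℚ) = (k : ℚ) := by rw [hk]
    _ ≤ ∑ a ∈ Finset.Ioo 0 k, ((q.choose a : ℕ) : ℚ) * ((k.choose (k - a) : ℕ) : ℚ)
          * (1 / ((((q + a).choose q : ℕ) : ℚ) * lostDemand M p q Z)) := harith
    _ = ∑ pr ∈ P, 1 / ((((q + pr.1.card).choose q : ℕ) : ℚ) * lostDemand M p q Z) := hstep4.symm
    _ ≤ ∑ pr ∈ P, 1 / bigDemand M p q (φ pr) := hstep3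
    _ = ∑ B ∈ P.image φ, 1 / bigDemand M p q B := hstep2.symm
    _ ≤ ∑ B ∈ Bf, 1 / bigDemand M p q B := hstep1

end PercRepro
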